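import Literature.NumberTheory.Automorphic.ArchBigCellDerivatives
import HarnessLib

/-!
# The inverse of the derivative of the big-cell chart, and the vector fields `L_X`, `R_X` in coordinates

Topic `NumberTheory/Automorphic`; namespace `Literature.NumberTheory.Automorphic`. For the chart
`Ψ(X₁, a, X₂) = (1 + X₁) w⁰ diag(a) (1 + X₂)` of the big cell of `GL_n(K_∞)` (`cellChart`) we make the
inverse of its derivative explicit: for `e = (X₁, a, X₂) ∈ cellSource` and a tangent vector `M ∈ M_n(K_∞)`,
with `M' = w⁰ (1 + X₁)⁻¹ M (1 + X₂)⁻¹` (`cellTwist`),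

  `dΨ_e⁻¹ M = ((1 + X₁) · w⁰ (low M' · diag(a)⁻¹) w⁰, diag M', diag(a)⁻¹ · up M' · (1 + X₂))`

(`cellTangentInv`, `cellChartDerivFun_cellTangentInv`, `cellChartDerivEquiv_symm_apply`): the triangular
solution already used for the surjectivity of `dΨ_e` in `ArchBigCellChartSmooth`. Consequently

* `fderiv_cellChartHomeo_symm`: `d(Ψ⁻¹)_{Ψ e} = dΨ_e⁻¹`;
* `cellVecL_eq`, `cellVecR_eq`: the vector fields of `L_X`, `R_X` (`ArchBigCellDerivatives`) are
  `cellVecL X e = dΨ_e⁻¹ (-X Ψ(e))`, `cellVecR X e = dΨ_e⁻¹ (Ψ(e) X)`, and any real combination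
  `Σ cᵢ cellVecL Yᵢ + Σ dⱼ cellVecR Xⱼ` is `d(Ψ⁻¹)_{Ψ e} (-(Σ cᵢ Yᵢ) Ψ(e) + Ψ(e) (Σ dⱼ Xⱼ))`
  (`sum_smul_cellVecL_add_sum_smul_cellVecR`);
* at a point `e₀ = (0, a, 0)` of the cell `w⁰ A`: the three components of `dΨ_{e₀}⁻¹ M` entrywise
  (`cellTangentInv_fst_apply_of_zero`, `cellTangentInv_snd_fst_of_zero`, `cellTangentInv_snd_snd_apply_of_zero`).

These formulas are the coordinate expressions used in the Gelfand–Kazhdan analysis of distributions near a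
small Bruhat cell (Shalika 1974, §2–§3). Everything is proved; no named fact is introduced.

## References

* J. A. Shalika, *The multiplicity one theorem for `GL_n`*, Ann. of Math. 100 (1974), §2–§3. [Shalika1974]
* L. Hörmander, *The Analysis of Linear Partial Differential Operators I* (1983), Thm. 1.1.7, §6.1
  (inverse function theorem, change of variables). [HormanderALPDO1]
-/

noncomputable section

open MeasureTheory Measure NumberField NumberField.mixedEmbedding IsDedekindDomain Set Filter Matrix
open Literature.Analysis.Distribution
open scoped MatrixGroups Topology Classical ContDiff Matrix.Norms.Operator

namespace Literature.NumberTheory.Automorphic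

variable {n : ℕ} {K : Type} [Field K] [NumberField K]

-- as in `ArchGardingWhittaker`: the scoped `L∞`-operator normed ring structure on matrices is only
-- reducibly defeq to the Pi uniformity
set_option backward.isDefEq.respectTransparency false

local notation "R∞" => mixedSpace K
local notation "Mat" => Matrix (Fin n) (Fin n) (mixedSpace K)
local notation "G∞" => GL (Fin n) (mixedSpace K)
local notation "E∞" => CellParam n (mixedSpace K)
local notation "w₀" => ((weylLong n (mixedSpace K) : GL (Fin n) (mixedSpace K)) : Matrix (Fin n) (Fin n) (mixedSpace K))

/-- `M_n(K_∞)` is finite-dimensional over `ℝ` (local instance, as in `ArchBigCellDerivatives`). [folklore] -/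
private theorem finiteDimensional_matrix_mixedSpace_ti : FiniteDimensional ℝ (Matrix (Fin n) (Fin n) (mixedSpace K)) :=
  Module.Finite.matrix

attribute [local instance] finiteDimensional_matrix_mixedSpace_ti

/-- The parameter space is finite-dimensional over `ℝ` (local instance). [folklore] -/
private theorem finiteDimensional_cellParam_ti : FiniteDimensional ℝ (CellParam n (mixedSpace K)) := by
  unfold CellParam; infer_instance

attribute [local instance] finiteDimensional_cellParam_ti

/-! ### 1. The explicit inverse of `dΨ_e` -/

section Inverse

/-- `(1 + X₁)⁻¹` at `e = (X₁, a, X₂)`. [folklore] -/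
def leftUnipInv (e : E∞) : Mat := (((unitri (e.1 : Mat) e.1.2)⁻¹ : G∞) : Mat)

/-- `(1 + X₂)⁻¹` at `e = (X₁, a, X₂)`. [folklore] -/
def rightUnipInv (e : E∞) : Mat := (((unitri (e.2.2 : Mat) e.2.2.2)⁻¹ : G∞) : Mat)

/-- `diag(a)⁻¹` at a point of `cellSource`. [folklore] -/
def diagInv (e : E∞) (he : e ∈ cellSource n R∞) : Mat := (((diagUnitsGL e.2.1 he)⁻¹ : G∞) : Mat)

/-- `(1 + X₁)⁻¹ (1 + X₁) = 1`. [folklore] -/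
theorem leftUnipInv_mul (e : E∞) : leftUnipInv e * (1 + (e.1 : Mat)) = 1 := by
  unfold leftUnipInv
  rw [← coe_unitri (e.1 : Mat) e.1.2, ← Units.val_mul, inv_mul_cancel, Units.val_one]

/-- `(1 + X₁) (1 + X₁)⁻¹ = 1`. [folklore] -/
theorem mul_leftUnipInv (e : E∞) : (1 + (e.1 : Mat)) * leftUnipInv e = 1 := by
  unfold leftUnipInv
  rw [← coe_unitri (e.1 : Mat) e.1.2, ← Units.val_mul, mul_inv_cancel, Units.val_one]

/-- `(1 + X₂)⁻¹ (1 + X₂) = 1`. [folklore] -/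
theorem rightUnipInv_mul (e : E∞) : rightUnipInv e * (1 + (e.2.2 : Mat)) = 1 := by
  unfold rightUnipInv
  rw [← coe_unitri (e.2.2 : Mat) e.2.2.2, ← Units.val_mul, inv_mul_cancel, Units.val_one]

/-- `(1 + X₂) (1 + X₂)⁻¹ = 1`. [folklore] -/
theorem mul_rightUnipInv (e : E∞) : (1 + (e.2.2 : Mat)) * rightUnipInv e = 1 := by
  unfold rightUnipInv
  rw [← coe_unitri (e.2.2 : Mat) e.2.2.2, ← Units.val_mul, mul_inv_cancel, Units.val_one]

/-- `diag(a)⁻¹ diag(a) = 1`. [folklore] -/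
theorem diagInv_mul {e : E∞} (he : e ∈ cellSource n R∞) : diagInv e he * diagonal e.2.1 = 1 := by
  unfold diagInv
  rw [← coe_diagUnitsGL e.2.1 he, ← Units.val_mul, inv_mul_cancel, Units.val_one]

/-- `diag(a) diag(a)⁻¹ = 1`. [folklore] -/
theorem mul_diagInv {e : E∞} (he : e ∈ cellSource n R∞) : diagonal e.2.1 * diagInv e he = 1 := by
  unfold diagInv
  rw [← coe_diagUnitsGL e.2.1 he, ← Units.val_mul, mul_inv_cancel, Units.val_one]

/-- `diag(a)⁻¹ = diag(a⁻¹)`. [folklore] -/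
theorem diagInv_eq {e : E∞} (he : e ∈ cellSource n R∞) :
    diagInv e he = diagonal fun i => (((he i).unit⁻¹ : (R∞)ˣ) : R∞) := rfl

/-- `(1 + X₁)⁻¹` is upper unitriangular. [folklore] -/
theorem leftUnipInv_apply_of_lt (e : E∞) {i j : Fin n} (hij : j < i) : leftUnipInv e i j = 0 :=
  ((mem_upperUnitriangular_iff _).1 (Subgroup.inv_mem _ (unitri_mem_upperUnitriangular (e.1 : Mat) e.1.2))).1 hij

/-- At `X₁ = 0`, `(1 + X₁)⁻¹ = 1`. [folklore] -/
theorem leftUnipInv_of_zero {e : E∞} (h : e.1 = 0) : leftUnipInv e = 1 := by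
  have h1 : (1 : Mat) + (e.1 : Mat) = 1 := by rw [h]; simp
  have := leftUnipInv_mul e
  rwa [h1, Matrix.mul_one] at this

/-- At `X₂ = 0`, `(1 + X₂)⁻¹ = 1`. [folklore] -/
theorem rightUnipInv_of_zero {e : E∞} (h : e.2.2 = 0) : rightUnipInv e = 1 := by
  have h1 : (1 : Mat) + (e.2.2 : Mat) = 1 := by rw [h]; simp
  have := rightUnipInv_mul e
  rwa [h1, Matrix.mul_one] at this

/-- **The twisted tangent vector** `M' = w⁰ (1 + X₁)⁻¹ M (1 + X₂)⁻¹`. [folklore] -/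
def cellTwist (e : E∞) (M : Mat) : Mat := w₀ * leftUnipInv e * M * rightUnipInv e

/-- `cellTwist e` is real-linear. [folklore] -/
theorem cellTwist_add (e : E∞) (M N : Mat) : cellTwist e (M + N) = cellTwist e M + cellTwist e N := by
  simp only [cellTwist, Matrix.mul_add, Matrix.add_mul]

/-- `cellTwist e` commutes with real scalars. [folklore] -/
theorem cellTwist_smul (e : E∞) (c : ℝ) (M : Mat) : cellTwist e (c • M) = c • cellTwist e M := by
  simp only [cellTwist, Matrix.mul_smul, Matrix.smul_mul]

/-- The first component of the explicit inverse is strictly upper. [folklore] -/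
theorem cellTangentInv_fst_mem {e : E∞} (he : e ∈ cellSource n R∞) (M : Mat) :
    (1 + (e.1 : Mat)) * (w₀ * (lowPart (cellTwist e M) * diagInv e he) * w₀) ∈ strictUpper n R∞ := by
  have hX₁up : ∀ i j : Fin n, j < i → ((1 : Mat) + (e.1 : Mat)) i j = 0 := fun i j hij => by
    rw [Matrix.add_apply, Matrix.one_apply, if_neg (ne_of_gt hij), (e.1.2 : (e.1 : Mat) ∈ strictUpper n R∞) i j hij.le,
      add_zero]
  refine upper_mul_strictUpper (weylLong_conj_mem_strictUpper ?_) hX₁up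
  rw [diagInv_eq]; exact (isStrictLower_lowPart _).mul_diagonal _

/-- The third component of the explicit inverse is strictly upper. [folklore] -/
theorem cellTangentInv_snd_snd_mem {e : E∞} (he : e ∈ cellSource n R∞) (M : Mat) :
    diagInv e he * upPart (cellTwist e M) * (1 + (e.2.2 : Mat)) ∈ strictUpper n R∞ := by
  have hX₂up : ∀ i j : Fin n, j < i → ((1 : Mat) + (e.2.2 : Mat)) i j = 0 := fun i j hij => by
    rw [Matrix.add_apply, Matrix.one_apply, if_neg (ne_of_gt hij), (e.2.2.2 : (e.2.2 : Mat) ∈ strictUpper n R∞) i j hij.le,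
      add_zero]
  refine strictUpper_mul_upper ?_ hX₂up
  rw [diagInv_eq]
  exact diagonal_mul_mem_strictUpper (upPart_mem_strictUpper _) _

/-- **The explicit inverse of `dΨ_e`**:
`dΨ_e⁻¹ M = ((1 + X₁) w⁰ (low M' diag(a)⁻¹) w⁰, diag M', diag(a)⁻¹ up M' (1 + X₂))`. [folklore] -/
def cellTangentInv (e : E∞) (he : e ∈ cellSource n R∞) (M : Mat) : E∞ :=
  (⟨(1 + (e.1 : Mat)) * (w₀ * (lowPart (cellTwist e M) * diagInv e he) * w₀), cellTangentInv_fst_mem he M⟩,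
   fun i => cellTwist e M i i,
   ⟨diagInv e he * upPart (cellTwist e M) * (1 + (e.2.2 : Mat)), cellTangentInv_snd_snd_mem he M⟩)

/-- Components of `cellTangentInv`. [folklore] -/
theorem cellTangentInv_fst {e : E∞} (he : e ∈ cellSource n R∞) (M : Mat) :
    ((cellTangentInv e he M).1 : Mat) = (1 + (e.1 : Mat)) * (w₀ * (lowPart (cellTwist e M) * diagInv e he) * w₀) := rfl

/-- Second component of `cellTangentInv`. [folklore] -/
theorem cellTangentInv_snd_fst {e : E∞} (he : e ∈ cellSource n R∞) (M : Mat) :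
    (cellTangentInv e he M).2.1 = fun i => cellTwist e M i i := rfl

/-- Third component of `cellTangentInv`. [folklore] -/
theorem cellTangentInv_snd_snd {e : E∞} (he : e ∈ cellSource n R∞) (M : Mat) :
    ((cellTangentInv e he M).2.2 : Mat) = diagInv e he * upPart (cellTwist e M) * (1 + (e.2.2 : Mat)) := rfl

/-- **`dΨ_e (cellTangentInv e M) = M`** (the computation of `cellChartDerivFun_surjective`). [folklore] -/
theorem cellChartDerivFun_cellTangentInv {e : E∞} (he : e ∈ cellSource n R∞) (M : Mat) :
    cellChartDerivFun e (cellTangentInv e he M) = M := by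
  set X₁ : Mat := (e.1 : Mat) with hX₁
  set X₂ : Mat := (e.2.2 : Mat) with hX₂
  set a : Fin n → R∞ := e.2.1 with ha
  set S₁ : Mat := leftUnipInv e with hS₁
  set S₂ : Mat := rightUnipInv e with hS₂
  set Dinv : Mat := diagInv e he with hDinv
  set M' : Mat := cellTwist e M with hM'
  have hww : w₀ * w₀ = 1 := weylLong_mul_weylLong
  have hDl : Dinv * diagonal a = 1 := diagInv_mul he
  have hDr : diagonal a * Dinv = 1 := mul_diagInv he
  have hS₁r : (1 + X₁) * S₁ = 1 := mul_leftUnipInv e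
  have hS₂l : S₂ * (1 + X₂) = 1 := rightUnipInv_mul e
  show (1 + X₁) * (w₀ * (lowPart M' * Dinv) * w₀) * w₀ * diagonal a * (1 + X₂) +
      (1 + X₁) * w₀ * diagonal (fun i => M' i i) * (1 + X₂) +
      (1 + X₁) * w₀ * diagonal a * (Dinv * upPart M' * (1 + X₂)) = M
  have h1 : (1 + X₁) * (w₀ * (lowPart M' * Dinv) * w₀) * w₀ * diagonal a * (1 + X₂) =
      (1 + X₁) * w₀ * lowPart M' * (1 + X₂) := by
    calc (1 + X₁) * (w₀ * (lowPart M' * Dinv) * w₀) * w₀ * diagonal a * (1 + X₂)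
        = (1 + X₁) * w₀ * lowPart M' * Dinv * (w₀ * w₀) * diagonal a * (1 + X₂) := by noncomm_ring
      _ = (1 + X₁) * w₀ * lowPart M' * (Dinv * diagonal a) * (1 + X₂) := by rw [hww]; noncomm_ring
      _ = (1 + X₁) * w₀ * lowPart M' * (1 + X₂) := by rw [hDl]; noncomm_ring
  have h3 : (1 + X₁) * w₀ * diagonal a * (Dinv * upPart M' * (1 + X₂)) = (1 + X₁) * w₀ * upPart M' * (1 + X₂) := by
    rw [show (1 + X₁) * w₀ * diagonal a * (Dinv * upPart M' * (1 + X₂)) =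
      (1 + X₁) * w₀ * (diagonal a * Dinv) * upPart M' * (1 + X₂) by noncomm_ring, hDr]
    noncomm_ring
  rw [h1, h3]
  have hsum := lowPart_add_diagonal_add_upPart M'
  calc (1 + X₁) * w₀ * lowPart M' * (1 + X₂) + (1 + X₁) * w₀ * diagonal (fun i => M' i i) * (1 + X₂) +
        (1 + X₁) * w₀ * upPart M' * (1 + X₂)
      = (1 + X₁) * w₀ * (lowPart M' + diagonal (fun i => M' i i) + upPart M') * (1 + X₂) := by noncomm_ring
    _ = (1 + X₁) * w₀ * M' * (1 + X₂) := by rw [hsum]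
    _ = M := by
        rw [hM', cellTwist, ← hS₁, ← hS₂,
          show (1 + X₁) * w₀ * (w₀ * S₁ * M * S₂) * (1 + X₂) = (1 + X₁) * (w₀ * w₀) * S₁ * M * (S₂ * (1 + X₂)) by
            noncomm_ring, hww, hS₂l, Matrix.mul_one, Matrix.mul_one, hS₁r, Matrix.one_mul]

/-- **`dΨ_e⁻¹ = cellTangentInv e`**. [folklore] -/
theorem cellChartDerivEquiv_symm_apply {e : E∞} (he : e ∈ cellSource n R∞) (M : Mat) :
    (cellChartDerivEquiv he).symm M = cellTangentInv e he M := by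
  apply (cellChartDerivEquiv he).injective
  rw [ContinuousLinearEquiv.apply_symm_apply]
  change M = (cellChartDerivEquiv he : E∞ →L[ℝ] Mat) (cellTangentInv e he M)
  rw [coe_cellChartDerivEquiv, fderiv_cellChart_apply, cellChartDerivFun_cellTangentInv]

/-- **`d(Ψ⁻¹)_{Ψ e} = dΨ_e⁻¹`** (`HasFDerivAt` form). [folklore] -/
theorem hasFDerivAt_cellChartHomeo_symm {e : E∞} (he : e ∈ cellSource n R∞) :
    HasFDerivAt (cellChartHomeo n R∞).symm (((cellChartDerivEquiv he).symm : Mat ≃L[ℝ] E∞) : Mat →L[ℝ] E∞) (cellChart e) := by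
  refine (cellChartHomeo n R∞).hasFDerivAt_symm ((cellChartHomeo n R∞).map_source he) ?_
  have h : (cellChartHomeo n R∞).symm (cellChart e) = e := symm_cellChart_apply he
  rw [h]
  exact (hasStrictFDerivAt_cellChart he).hasFDerivAt

/-- **`d(Ψ⁻¹)_{Ψ e} = dΨ_e⁻¹`** (`fderiv` form). [folklore] -/
theorem fderiv_cellChartHomeo_symm {e : E∞} (he : e ∈ cellSource n R∞) :
    fderiv ℝ (cellChartHomeo n R∞).symm (cellChart e) = (((cellChartDerivEquiv he).symm : Mat ≃L[ℝ] E∞) : Mat →L[ℝ] E∞) :=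
  (hasFDerivAt_cellChartHomeo_symm he).fderiv

/-- `d(Ψ⁻¹)_{Ψ e} M = cellTangentInv e M`. [folklore] -/
theorem fderiv_cellChartHomeo_symm_apply {e : E∞} (he : e ∈ cellSource n R∞) (M : Mat) :
    fderiv ℝ (cellChartHomeo n R∞).symm (cellChart e) M = cellTangentInv e he M := by
  rw [fderiv_cellChartHomeo_symm he]
  exact cellChartDerivEquiv_symm_apply he M

/-! ### 2. The vector fields `cellVecL`, `cellVecR` in coordinates -/

/-- **`cellVecL Y e = dΨ_e⁻¹ (-Y Ψ(e))`.** [folklore] -/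
theorem cellVecL_eq {e : E∞} (he : e ∈ cellSource n R∞) (Y : Mat) :
    cellVecL Y e = cellTangentInv e he (-(Y * cellChart e)) := by
  unfold cellVecL
  exact fderiv_cellChartHomeo_symm_apply he _

/-- **`cellVecR X e = dΨ_e⁻¹ (Ψ(e) X)`.** [folklore] -/
theorem cellVecR_eq {e : E∞} (he : e ∈ cellSource n R∞) (X : Mat) :
    cellVecR X e = cellTangentInv e he (cellChart e * X) := by
  unfold cellVecR
  exact fderiv_cellChartHomeo_symm_apply he _

/-- **Combinations of the fields with real coefficients**:
`Σ cᵢ cellVecL Yᵢ e + Σ dⱼ cellVecR Xⱼ e = d(Ψ⁻¹)_{Ψ e} (-(Σ cᵢ Yᵢ) Ψ(e) + Ψ(e) (Σ dⱼ Xⱼ))` (at every `e`, by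
linearity of `d(Ψ⁻¹)_{Ψ e}`). [folklore] -/
theorem sum_smul_cellVecL_add_sum_smul_cellVecR {ι κ : Type*} [Fintype ι] [Fintype κ] (c : ι → ℝ) (Y : ι → Mat)
    (d : κ → ℝ) (X : κ → Mat) (e : E∞) :
    ∑ i, c i • cellVecL (Y i) e + ∑ k, d k • cellVecR (X k) e =
      fderiv ℝ (cellChartHomeo n R∞).symm (cellChart e) (-((∑ i, c i • Y i) * cellChart e) + cellChart e * ∑ k, d k • X k) := by
  set Φ := fderiv ℝ (cellChartHomeo n R∞).symm (cellChart e) with hΦ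
  have hL : ∀ i, c i • cellVecL (Y i) e = Φ (-((c i • Y i) * cellChart e)) := fun i => by
    unfold cellVecL
    rw [← hΦ, Matrix.smul_mul, ← smul_neg, _root_.map_smul]
  have hR : ∀ k, d k • cellVecR (X k) e = Φ (cellChart e * (d k • X k)) := fun k => by
    unfold cellVecR
    rw [← hΦ, Matrix.mul_smul, _root_.map_smul]
  simp_rw [hL, hR]
  rw [← _root_.map_sum, ← _root_.map_sum, ← map_add]
  congr 1
  rw [Finset.sum_neg_distrib, Finset.sum_mul, Finset.mul_sum]

/-! ### 3. The components at a point `e₀ = (0, a, 0)` -/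

/-- At `e₀ = (0, a, 0)`, `M' = w⁰ M`. [folklore] -/
theorem cellTwist_of_zero {e : E∞} (h₁ : e.1 = 0) (h₂ : e.2.2 = 0) (M : Mat) : cellTwist e M = w₀ * M := by
  rw [cellTwist, leftUnipInv_of_zero h₁, rightUnipInv_of_zero h₂, Matrix.mul_one, Matrix.mul_one]

/-- Entries of `lowPart`. [folklore] -/
theorem lowPart_apply' (M : Mat) (i j : Fin n) : lowPart M i j = if j < i then M i j else 0 := rfl

/-- Entries of `upPart`. [folklore] -/
theorem upPart_apply' (M : Mat) (i j : Fin n) : upPart M i j = if i < j then M i j else 0 := rfl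

/-- **First component at `e₀ = (0, a, 0)`**: `(dΨ⁻¹ M)₁ (p, q) = [p < q] · M (p, rev q) · a(rev q)⁻¹`.
[folklore] -/
theorem cellTangentInv_fst_apply_of_zero {e : E∞} (he : e ∈ cellSource n R∞) (h₁ : e.1 = 0) (h₂ : e.2.2 = 0) (M : Mat)
    (p q : Fin n) :
    ((cellTangentInv e he M).1 : Mat) p q =
      if p < q then M p q.rev * (((he q.rev).unit⁻¹ : (R∞)ˣ) : R∞) else 0 := by
  have h1' : (1 : Mat) + (e.1 : Mat) = 1 := by rw [h₁]; simp
  rw [cellTangentInv_fst, cellTwist_of_zero h₁ h₂, diagInv_eq he, h1', Matrix.one_mul, weylLong_conj_apply,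
    Matrix.mul_diagonal, lowPart_apply', weylLong_mul_apply, Fin.rev_rev]
  by_cases hpq : p < q
  · rw [if_pos (Fin.rev_lt_rev.2 hpq), if_pos hpq]
  · rw [if_neg (fun h => hpq (Fin.rev_lt_rev.1 h)), if_neg hpq, zero_mul]

/-- **Second component at `e₀ = (0, a, 0)`**: `(dΨ⁻¹ M)₂ i = M (rev i, i)`. [folklore] -/
theorem cellTangentInv_snd_fst_of_zero {e : E∞} (he : e ∈ cellSource n R∞) (h₁ : e.1 = 0) (h₂ : e.2.2 = 0) (M : Mat)
    (i : Fin n) : (cellTangentInv e he M).2.1 i = M i.rev i := by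
  rw [cellTangentInv_snd_fst, cellTwist_of_zero h₁ h₂]
  show (w₀ * M) i i = M i.rev i
  rw [weylLong_mul_apply]

/-- **Third component at `e₀ = (0, a, 0)`**: `(dΨ⁻¹ M)₃ (p, q) = [p < q] · a(p)⁻¹ · M (rev p, q)`. [folklore] -/
theorem cellTangentInv_snd_snd_apply_of_zero {e : E∞} (he : e ∈ cellSource n R∞) (h₁ : e.1 = 0) (h₂ : e.2.2 = 0) (M : Mat)
    (p q : Fin n) :
    ((cellTangentInv e he M).2.2 : Mat) p q =
      if p < q then (((he p).unit⁻¹ : (R∞)ˣ) : R∞) * M p.rev q else 0 := by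
  have h2' : (1 : Mat) + (e.2.2 : Mat) = 1 := by rw [h₂]; simp
  rw [cellTangentInv_snd_snd, cellTwist_of_zero h₁ h₂, diagInv_eq he, h2', Matrix.mul_one, Matrix.diagonal_mul, upPart_apply',
    weylLong_mul_apply]
  by_cases hpq : p < q
  · rw [if_pos hpq, if_pos hpq]
  · rw [if_neg hpq, if_neg hpq, mul_zero]

/-- **The chart at `e₀ = (0, a, 0)`**: `Ψ(e₀) = w⁰ diag(a)`. [folklore] -/
theorem cellChart_of_zero {e : E∞} (h₁ : e.1 = 0) (h₂ : e.2.2 = 0) : cellChart e = w₀ * diagonal e.2.1 := by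
  rw [cellChart_apply, h₁, h₂]
  simp

end Inverse

end Literature.NumberTheory.Automorphic
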